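import Mathlib.Analysis.InnerProductSpace.Projection.Basic
import Mathlib.Analysis.InnerProductSpace.Adjoint
import Literature.Analysis.UnboundedOperators.UnitaryRep
import HarnessLib

/-!
# Orthogonal projections, commutants and invariant subspaces of a unitary representation

Topic `RepresentationTheory/Unitary`; namespace `Literature.RepresentationTheory.Unitary`. The elementary
operator algebra behind "the orthogonal projection onto an isotypic component of a unitary representation lies in
the von Neumann algebra generated by the representation, hence preserves every closed invariant subspace"
(Dixmier, *Von Neumann algebras* (1981), Part I, Ch. 1, §§1.3–1.4; Mackey, *The theory of unitary group
representations* (1976), Ch. 1), for ANY group `G` acting by a homomorphism `R : G →* (H →L[ℂ] H)` with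
`⟪R g u, R g v⟫ = ⟪u, v⟫` on a complex inner product space `H` (completeness only where adjoints are taken):

* `AdjointClosed S`, `Invariant S M`; `invariant_orthogonal` — `M` invariant under an adjoint-closed `S` ⇒ `Mᗮ`
  invariant; `starProjection_commute` — the projection onto `M` commutes with an operator preserving `M` and `Mᗮ`;
* `starProjection_mem_commutant` — the orthogonal projection onto a closed `S`-invariant subspace lies in the
  commutant `S′ = Set.centralizer S`;
* `preserves_of_mem_bicommutant` — any operator of the bicommutant `S″` preserves every closed `S`-invariant
  subspace (we work with `S″` directly; von Neumann's density theorem `S″ = W*(S)` is not needed or proved);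
* `IsUnitaryRep R` (unbundled) with `IsUnitaryRep.adjointClosed` (`(R g)† = R g⁻¹`), `adjoint_mem_commutant`,
  `adjointClosed_commutant` (`R(G)′` is a `*`-algebra);
* `starProjection_mem_bicommutant` — the projection onto a closed subspace stable under `R(G)′` (an isotypic
  component) lies in `R(G)″`; `isotypic_projection_preserves` — hence preserves every closed invariant subspace;
* `UnitaryRep.isUnitaryRep_toMonoidHom` — bridge from the tree's bundled strongly continuous
  `Literature.Analysis.UnboundedOperators.UnitaryRep` [Folland1995].

Everything is proved (Mathlib + the tree's `UnitaryRep`). Mathlib has `Set.centralizer`,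
`Submodule.starProjection`, `ContinuousLinearMap.adjoint`, `VonNeumannAlgebra.commutant`, but not these
invariant-subspace lemmas (`lean search 'starProjection_comm|commute_starProjection'`: only the self-adjoint
special case `Literature.NumberTheory.Automorphic.commute_starProjection_of_invariant`).

## Provenance

Reproduced for the tree under the LEAN-IN-TREE rule (2026-08-18) from the pub-hodgecm formalisation cell's
standalone package file `HodgeCM/PerL34/Spectral.lean` (DAG-node prover #09 lineage, seat pv09, gate run 22;
there the kernel of the "spectral paragraph" node), verbatim up to the namespace
(`HodgeCM.PerL34.Spectral` ↦ `Literature.RepresentationTheory.Unitary`), the docstrings and the added bridge.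
-/

set_option autoImplicit false

open scoped InnerProductSpace
open ContinuousLinearMap

namespace Literature.RepresentationTheory.Unitary

variable {H : Type*} [NormedAddCommGroup H] [InnerProductSpace ℂ H]

/-- A set `S` of bounded operators is *adjoint-closed* in the weak sense used here: every `A ∈ S` has a formal
adjoint inside `S`.  (No completeness needed to state it; for a unitary representation `(R g)† = R g⁻¹`.)
[folklore] -/
def AdjointClosed (S : Set (H →L[ℂ] H)) : Prop :=
  ∀ A ∈ S, ∃ B ∈ S, ∀ u v : H, ⟪A u, v⟫_ℂ = ⟪u, B v⟫_ℂ

/-- `S`-invariance of a submodule: every operator of `S` maps `M` into `M`. [folklore] -/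
def Invariant (S : Set (H →L[ℂ] H)) (M : Submodule ℂ H) : Prop := ∀ A ∈ S, ∀ v ∈ M, A v ∈ M

/-- If `M` is invariant under an adjoint-closed set of operators, so is `Mᗮ`. [folklore] -/
theorem invariant_orthogonal {S : Set (H →L[ℂ] H)} (hS : AdjointClosed S) {M : Submodule ℂ H}
    (hM : Invariant S M) : Invariant S Mᗮ := by
  intro A hA v hv
  rw [Submodule.mem_orthogonal] at hv ⊢
  intro m hm
  obtain ⟨B, hB, hAB⟩ := hS A hA
  -- ⟪m, A v⟫ = conj ⟪A v, m⟫ = conj ⟪v, B m⟫ = ⟪B m, v⟫ = 0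
  rw [← inner_conj_symm, hAB, inner_conj_symm]
  exact hv (B m) (hM B hB m hm)

/-- The orthogonal projection onto `M` commutes with an operator leaving both `M` and `Mᗮ` invariant
(the self-adjoint special case is `Literature.NumberTheory.Automorphic.commute_starProjection_of_invariant`).
[folklore] -/
theorem starProjection_commute {M : Submodule ℂ H} [M.HasOrthogonalProjection] {A : H →L[ℂ] H}
    (hM : ∀ v ∈ M, A v ∈ M) (hM' : ∀ v ∈ Mᗮ, A v ∈ Mᗮ) :
    A * M.starProjection = M.starProjection * A := by
  ext x
  simp only [mul_apply_eq_comp]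
  have hx : x = M.starProjection x + (x - M.starProjection x) := by abel
  have h1 : M.starProjection (A (M.starProjection x)) = A (M.starProjection x) :=
    (M.starProjection_eq_self_iff).mpr (hM _ (M.starProjection_apply_mem x))
  have h2 : M.starProjection (A (x - M.starProjection x)) = 0 :=
    (M.starProjection_apply_eq_zero_iff).mpr (hM' _ (M.sub_starProjection_mem_orthogonal x))
  conv_rhs => rw [hx, map_add, map_add, h1, h2, add_zero]

/-- The orthogonal projection onto a closed `S`-invariant subspace lies in the commutant `S′ = Set.centralizer S`
(`S` adjoint-closed) (Dixmier, *Von Neumann algebras* (1981), Part I, Ch. 1, §1.3). [folklore] -/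
theorem starProjection_mem_commutant {S : Set (H →L[ℂ] H)} (hS : AdjointClosed S) {M : Submodule ℂ H}
    [M.HasOrthogonalProjection] (hM : Invariant S M) :
    M.starProjection ∈ Set.centralizer S := by
  intro A hA
  exact starProjection_commute (hM A hA) (invariant_orthogonal hS hM A hA)

/-- An operator in the bicommutant `S″` of an adjoint-closed set `S` preserves every closed
(`HasOrthogonalProjection`) `S`-invariant subspace — the elementary half of "the von Neumann algebra generated by
`S` has the same closed invariant subspaces as `S`" (von Neumann's bicommutant theorem being the other half,
not needed here). [folklore] -/
theorem preserves_of_mem_bicommutant {S : Set (H →L[ℂ] H)} (hS : AdjointClosed S) {e : H →L[ℂ] H}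
    (he : e ∈ Set.centralizer (Set.centralizer S)) {M : Submodule ℂ H} [M.HasOrthogonalProjection]
    (hM : Invariant S M) : ∀ v ∈ M, e v ∈ M := by
  intro v hv
  have hcomm : M.starProjection * e = e * M.starProjection := he _ (starProjection_mem_commutant hS hM)
  have : e v = M.starProjection (e v) := by
    have h := congrArg (fun T : H →L[ℂ] H => T v) hcomm
    simp only [mul_apply_eq_comp] at h
    rw [Submodule.starProjection_eq_self_iff.mpr hv] at h
    exact h.symm
  rw [this]
  exact M.starProjection_apply_mem _

section unitary

variable {G : Type*} [Group G]

/-- A unitary representation in the UNBUNDLED sense: a homomorphism `R : G →* (H →L[ℂ] H)` preserving the inner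
product (no topology on `G`, no continuity). The tree's bundled, strongly continuous notion is
`Literature.Analysis.UnboundedOperators.UnitaryRep` [Folland1995]; see `UnitaryRep.isUnitaryRep_toMonoidHom`
below for the bridge. [folklore] -/
def IsUnitaryRep (R : G →* (H →L[ℂ] H)) : Prop := ∀ (g : G) (u v : H), ⟪R g u, R g v⟫_ℂ = ⟪u, v⟫_ℂ

/-- `⟪R g u, v⟫ = ⟪u, R g⁻¹ v⟫`: the formal adjoint of `R g` is `R g⁻¹`. [folklore] -/
theorem IsUnitaryRep.inner_apply_left {R : G →* (H →L[ℂ] H)} (hR : IsUnitaryRep R) (g : G) (u v : H) :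
    ⟪R g u, v⟫_ℂ = ⟪u, R g⁻¹ v⟫_ℂ := by
  conv_lhs => rw [show v = R g (R g⁻¹ v) by
    rw [← mul_apply_eq_comp, ← map_mul, mul_inv_cancel, map_one]; rfl]
  exact hR g u _

/-- The range of a unitary representation is adjoint-closed: `(R g)† = R g⁻¹`. [folklore] -/
theorem IsUnitaryRep.adjointClosed {R : G →* (H →L[ℂ] H)} (hR : IsUnitaryRep R) :
    AdjointClosed (Set.range R) := by
  rintro _ ⟨g, rfl⟩
  exact ⟨R g⁻¹, ⟨g⁻¹, rfl⟩, hR.inner_apply_left g⟩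

/-- `Invariant (range R) M` unfolds to `∀ g, ∀ v ∈ M, R g v ∈ M`. [folklore] -/
theorem invariant_range_iff {R : G →* (H →L[ℂ] H)} {M : Submodule ℂ H} :
    Invariant (Set.range R) M ↔ ∀ g : G, ∀ v ∈ M, R g v ∈ M := by
  constructor
  · intro h g v hv; exact h (R g) ⟨g, rfl⟩ v hv
  · rintro h _ ⟨g, rfl⟩ v hv; exact h g v hv

/-- An operator in the bicommutant `R(G)″` of a unitary representation preserves every closed `R(G)`-invariant
subspace. [folklore] -/
theorem preserves_of_mem_bicommutant_range {R : G →* (H →L[ℂ] H)} (hR : IsUnitaryRep R) {e : H →L[ℂ] H}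
    (he : e ∈ Set.centralizer (Set.centralizer (Set.range R))) (M : Submodule ℂ H)
    [M.HasOrthogonalProjection] (hM : ∀ g : G, ∀ v ∈ M, R g v ∈ M) : ∀ v ∈ M, e v ∈ M :=
  preserves_of_mem_bicommutant hR.adjointClosed he (invariant_range_iff.mpr hM)

variable [CompleteSpace H]

/-- The commutant of the range of a unitary representation is closed under Hilbert-space adjoints
(`(R g)† = R g⁻¹` and `(A B)† = B† A†`). [folklore] -/
theorem adjoint_mem_commutant {R : G →* (H →L[ℂ] H)} (hR : IsUnitaryRep R) {A : H →L[ℂ] H}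
    (hA : A ∈ Set.centralizer (Set.range R)) : adjoint A ∈ Set.centralizer (Set.range R) := by
  rintro _ ⟨g, rfl⟩
  -- adjoint (R g) = R g⁻¹, and A commutes with R g⁻¹
  have hadj : ∀ h : G, adjoint (R h) = R h⁻¹ := fun h =>
    (ContinuousLinearMap.eq_adjoint_iff _ _).mpr (fun x y => by rw [hR.inner_apply_left, inv_inv]) |>.symm
  have hc : R g⁻¹ * A = A * R g⁻¹ := hA (R g⁻¹) ⟨g⁻¹, rfl⟩
  have := congrArg adjoint hc
  rw [← ContinuousLinearMap.star_eq_adjoint, ← ContinuousLinearMap.star_eq_adjoint, star_mul, star_mul,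
    ContinuousLinearMap.star_eq_adjoint, ContinuousLinearMap.star_eq_adjoint, hadj, inv_inv] at this
  exact this.symm

/-- The commutant `R(G)′` of a unitary representation is adjoint-closed (a `*`-subalgebra). [folklore] -/
theorem adjointClosed_commutant {R : G →* (H →L[ℂ] H)} (hR : IsUnitaryRep R) :
    AdjointClosed (Set.centralizer (Set.range R)) := fun A hA =>
  ⟨adjoint A, adjoint_mem_commutant hR hA, fun u v => (ContinuousLinearMap.adjoint_inner_right A u v).symm⟩

/-- **Isotypic projections lie in `R(G)″`**: if the closed subspace `σ` is stable under the commutant `R(G)′` — the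
characteristic property of an isotypic component of a unitary representation — then its orthogonal projection
commutes with `R(G)′`, i.e. lies in the von Neumann algebra `R(G)″` (Dixmier (1981), Part I, Ch. 1, §1.3–1.4;
Mackey, *The theory of unitary group representations* (1976), Ch. 1). [folklore] -/
theorem starProjection_mem_bicommutant {R : G →* (H →L[ℂ] H)} (hR : IsUnitaryRep R) (σ : Submodule ℂ H)
    [σ.HasOrthogonalProjection]
    (hσ : ∀ A ∈ Set.centralizer (Set.range R), ∀ x ∈ σ, A x ∈ σ) :
    σ.starProjection ∈ Set.centralizer (Set.centralizer (Set.range R)) :=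
  starProjection_mem_commutant (adjointClosed_commutant hR) hσ

/-- The two combined: for a unitary representation `R` and a closed subspace `σ` stable under the commutant `R(G)′`,
the orthogonal projection `e_σ` preserves every closed `R(G)`-invariant subspace `M`. [folklore] -/
theorem isotypic_projection_preserves {R : G →* (H →L[ℂ] H)} (hR : IsUnitaryRep R) (σ : Submodule ℂ H)
    [σ.HasOrthogonalProjection] (hσ : ∀ A ∈ Set.centralizer (Set.range R), ∀ x ∈ σ, A x ∈ σ)
    (M : Submodule ℂ H) [M.HasOrthogonalProjection] (hM : ∀ g : G, ∀ v ∈ M, R g v ∈ M) :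
    ∀ v ∈ M, σ.starProjection v ∈ M :=
  preserves_of_mem_bicommutant_range hR (starProjection_mem_bicommutant hR σ hσ) M hM

/-- BRIDGE to the tree's bundled notion (a deliberate dot-notation extension of the structure
`Literature.Analysis.UnboundedOperators.UnitaryRep`, which lives in another directory): a strongly continuous
unitary representation [Folland1995, §3.1] is a unitary representation in the unbundled sense `IsUnitaryRep`,
so every theorem of this file applies to `U.toMonoidHom`. [folklore] -/
theorem _root_.Literature.Analysis.UnboundedOperators.UnitaryRep.isUnitaryRep_toMonoidHom
    {G : Type*} [Group G] [TopologicalSpace G]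
    (U : Literature.Analysis.UnboundedOperators.UnitaryRep G H) : IsUnitaryRep U.toMonoidHom :=
  fun g u v => ContinuousLinearMap.inner_map_map_of_mem_unitary (U.mem_unitary g) u v

end unitary

end Literature.RepresentationTheory.Unitary
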